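import Summits.QuantumAdvantage.QuantumAdvantage.Theses.RingFrame
import Summits.QuantumAdvantage.AdviceFreeQNC0.AdviceFreeQNC0
import Literature.Computability.MetaComplexity.SmolenskyRelations
import Literature.Computability.QuantumComplexity.ShallowCircuitsAncillas
import Literature.Computability.QuantumComplexity.ShallowCircuitsEncodeProofs
import Literature.Computability.Complexity.Classes
import HarnessLib

/-!
# Route RingFrame, item `BridgeRingToSep` (stmt-QuantumAdvantage-19124): `RingHard p → HLFNotFAC0Mod p → AdviceFreeQNC0Sep p`

The two reductions that turn the cell's crux `RingHard p` (`Summits/QuantumAdvantage/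
AdviceFreeQNC0/AdviceFreeQNC0.lean`: no polylog-degree `𝔽_p`-polynomial map solves the ring
graph-state relation `RingHLF.Rel` on more than a `θ`-fraction of the patterns) into the
printed-open target `AdviceFreeQNC0Sep p` (advice-free `QNC⁰` versus `FAC⁰[p]` circuit tuples with
uniform shared random bits, relation problems), both PROVED here, and the route item
`Summit.QuantumAdvantage.QuantumAdvantage.Theses.RingFrame.BridgeRingToSep` (`RingHard 2 →
AdviceFreeQNC0`) closed by name (`bridgeRingToSep_proof`):

* `hlfNotFAC0Mod_of_ringHard8` (`… _of_ringHard`) — `RingHard8 p → HLFNotFAC0Mod p`. Given `AC⁰[p]/rpoly` circuits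
  for `N × N` 2D-HLF (depth `d`, size `≤ s(N)`), restrict them to the CYCLE instances
  `ringInstance γ x` of a grid cycle `γ` of length `8t`, `t = ⌊(N-1)/2⌋`
  (tree `GridCycle.square`): the input string is a projection of the pattern `x`
  (`GridCycle.encodeHLF_ringInstance_subst`), so the relational Razborov–Smolensky lemma
  (tree `Smolensky.exists_uniformProb_le`: hard-wiring + `razborov_smolensky_multi` + averaging
  over the random bits) produces a pattern `x` on which the success probability is at most
  `θ₀ + N²(s(N)+2)/p^ℓ`, because every polynomial map solving HLF on the cycle instance solves
  the ring relation on its cycle outputs (`GridCycle.rel_of_mem_hlfSolutions`) and `RingHard`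
  bounds those; with `ℓ = (log₂ N + 1)(k+3)` (`s(N) = O(N^k)`) the error term is `≤ (1-θ₀)/2`
  and the degree `((p-1)ℓ)^{d+1}` is `≤ (log₂(8t))^{d+2}` for large `N`.
* `adviceFreeQNC0Sep_of_hlfNotFAC0Mod` — `HLFNotFAC0Mod p → AdviceFreeQNC0Sep p`, with the
  tree's relation family `hlfFamily`, `qnc0Solves_hlfFamily` (BGK's depth-`98` circuit with `N²`
  ancillas, certainty, every `N`) and `faccHard_hlfFamily` (`ShallowCircuitRelations.lean`).
* `adviceFreeQNC0Sep_of_ringHard8` / `adviceFreeQNC0Sep_of_ringHard` — the composites (the bridge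
  consumes ring hardness only at lengths `8t`).

So the rung leaf `AdviceFreeQNC0` is reduced, in the kernel, to ONE combinatorial statement about
low-degree polynomial maps on the ring (`RingHard 2`; the route's crux α `RingToElim` supplies it
from the proved elimination hardness), which remains OPEN.

WHAT THIS IS NOT: no lower bound is proved here; `RingHard p` is a hypothesis.
-/

noncomputable section

open Finset Polynomial
open Literature.Computability.Cryptography Literature.Computability.Complexity
open Literature.Computability.QuantumComplexity Literature.Computability.MetaComplexity

-- the sub-problem namespace `Summit.QuantumAdvantage.QuantumAdvantage` repeats the summit name by design (D-0017)
set_option linter.dupNamespace false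

namespace Summit.QuantumAdvantage.QuantumAdvantage.Theorems

open Summit.QuantumAdvantage.AdviceFreeQNC0

/-! ### From 2D-HLF hardness to the target -/

/-- **`HLFNotFAC0Mod p → AdviceFreeQNC0Sep p`** (planner qa-qnc0-p1's `HLFGivesSep`): 2D HLF is
the witnessing relation family. -/
theorem adviceFreeQNC0Sep_of_hlfNotFAC0Mod (p : ℕ) (h : HLFNotFAC0Mod p) : AdviceFreeQNC0Sep p := by
  obtain ⟨θ, hθ, hrest⟩ := h
  exact ⟨hlfFamily, ⟨3 * X ^ 2, hlfFamily_inLen_le⟩, qnc0Solves_hlfFamily, θ, hθ,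
    faccHard_hlfFamily hrest⟩

/-! ### From ring hardness to 2D-HLF hardness -/

/-- Arithmetic: `N^K ≤ 2^{(log₂ N + 1)·K}`. -/
private theorem pow_le_two_pow_log_succ_mul (N K : ℕ) :
    N ^ K ≤ 2 ^ ((Nat.log 2 N + 1) * K) := by
  rw [pow_mul]
  exact Nat.pow_le_pow_left (Nat.lt_pow_succ_log_self one_lt_two N).le K

/-- Arithmetic: the degree bound. With `A = 2(p-1)K`, `A^{d+1} ≤ L` forces
`((p-1)·(L+1)·K)^{d+1} ≤ L^{d+2}`. -/
private theorem degree_bound {p K L d : ℕ} (hK : 1 ≤ K) (hp : 1 ≤ p - 1)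
    (hA : (2 * (p - 1) * K) ^ (d + 1) ≤ L) :
    ((p - 1) * ((L + 1) * K)) ^ (d + 1) ≤ L ^ (d + 2) := by
  have hApos : 1 ≤ 2 * (p - 1) * K := by nlinarith
  have hL : 1 ≤ L := le_trans (Nat.one_le_pow _ _ hApos) hA
  calc ((p - 1) * ((L + 1) * K)) ^ (d + 1)
      ≤ (2 * (p - 1) * K * L) ^ (d + 1) := by
        apply Nat.pow_le_pow_left
        nlinarith
    _ = (2 * (p - 1) * K) ^ (d + 1) * L ^ (d + 1) := by rw [mul_pow]
    _ ≤ L * L ^ (d + 1) := Nat.mul_le_mul_right _ hA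
    _ = L ^ (d + 2) := by ring

/-- Arithmetic: the error term. For `N ≥ 1`, `s(N) ≤ c N^k + c` and `(2c+2) ≤ δ N`:
`N²(s(N)+2)/D ≤ δ` whenever `N^{k+3} ≤ D`. -/
private theorem error_bound {N k c : ℕ} {sN D δ : ℝ} (hN : 1 ≤ N) (hs : sN ≤ c * (N : ℝ) ^ k + c)
    (hδ : (2 * c + 2 : ℝ) ≤ δ * N) (hD : ((N : ℝ)) ^ (k + 3) ≤ D) (hDpos : 0 < D) :
    (N : ℝ) * N * (sN + 2) / D ≤ δ := by
  have hN' : (1 : ℝ) ≤ N := by exact_mod_cast hN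
  have hNk : (1 : ℝ) ≤ (N : ℝ) ^ k := one_le_pow₀ hN'
  rw [div_le_iff₀ hDpos]
  have h1 : sN + 2 ≤ (2 * c + 2) * (N : ℝ) ^ k := by nlinarith
  have h2 : (N : ℝ) * N * (sN + 2) ≤ (N : ℝ) * N * ((2 * c + 2) * (N : ℝ) ^ k) := by
    have : (0 : ℝ) ≤ (N : ℝ) * N := by positivity
    exact mul_le_mul_of_nonneg_left h1 this
  calc (N : ℝ) * N * (sN + 2) ≤ (N : ℝ) * N * ((2 * c + 2) * (N : ℝ) ^ k) := h2
    _ = (2 * c + 2) * (N : ℝ) ^ (k + 2) := by ring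
    _ ≤ δ * N * (N : ℝ) ^ (k + 2) := by
        have : (0 : ℝ) ≤ (N : ℝ) ^ (k + 2) := by positivity
        exact mul_le_mul_of_nonneg_right hδ this
    _ = δ * (N : ℝ) ^ (k + 3) := by ring
    _ ≤ δ * D := by
        have hδ0 : 0 ≤ δ := by
          have : (0 : ℝ) < 2 * c + 2 := by positivity
          nlinarith
        exact mul_le_mul_of_nonneg_left hD hδ0

/-- **`RingHard8 p → HLFNotFAC0Mod p`**: restricting `N × N` 2D-HLF circuits to the cycle
instances of the `8t`-cycle `GridCycle.square t`, `t = ⌊(N−1)/2⌋`, and applying the relational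
Razborov–Smolensky lemma (tree `Smolensky.exists_uniformProb_le`) together with the HLF→ring
transfer (tree `GridCycle.rel_of_mem_hlfSolutions`) and the input projection (tree
`GridCycle.encodeHLF_ringInstance_subst`). The threshold obtained is `(1 + θ₀)/2` from the ring
threshold `θ₀`. -/
theorem hlfNotFAC0Mod_of_ringHard8 (p : ℕ) [Fact p.Prime] (h : RingHard8 p) : HLFNotFAC0Mod p := by
  classical
  have hp := (Fact.out : p.Prime)
  obtain ⟨θ₀, hθ₀, hhard⟩ := h
  set δ : ℝ := (1 - θ₀) / 2 with hδ
  have hδpos : 0 < δ := by rw [hδ]; linarith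
  refine ⟨θ₀ + δ, by rw [hδ]; linarith, fun d s => ?_⟩
  -- size bound `s(N) ≤ cs N^ks + cs`
  obtain ⟨cs, ks, hcs⟩ := exists_eval_le_mul_pow_add s
  -- ring hardness at exponent `d + 2`
  obtain ⟨n₀, hn₀⟩ := hhard (d + 2)
  -- the thresholds
  set K : ℕ := ks + 3 with hK
  set A : ℕ := 2 * (p - 1) * K with hA
  set M : ℕ := ⌈1 / δ⌉₊ with hM
  refine ⟨max (max 5 (2 * n₀ + 1)) (max (M * (2 * cs + 2)) (2 ^ (A ^ (d + 1)))),
    fun N hN r Cs hover hdep hsize => ?_⟩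
  have hN5 : 5 ≤ N := le_trans (le_max_left _ _) (le_trans (le_max_left _ _) hN)
  have hNn₀ : 2 * n₀ + 1 ≤ N := le_trans (le_max_right _ _) (le_trans (le_max_left _ _) hN)
  have hNM : M * (2 * cs + 2) ≤ N := le_trans (le_max_left _ _) (le_trans (le_max_right _ _) hN)
  have hNA : 2 ^ (A ^ (d + 1)) ≤ N := le_trans (le_max_right _ _) (le_trans (le_max_right _ _) hN)
  -- the cycle of length `8t` in the grid
  set t : ℕ := (N - 1) / 2 with ht
  have ht2 : 2 ≤ t := by omega
  have htN : 2 * t < N := by omega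
  have hn3 : 3 ≤ 8 * t := by omega
  have hNn : N ≤ 8 * t := by omega
  have ht₀ : n₀ ≤ t := by omega
  let γ : GridCycle N (8 * t) := GridCycle.square t ht2 htN
  -- the Razborov–Smolensky parameter
  set L : ℕ := Nat.log 2 N with hL
  set ℓ : ℕ := (L + 1) * K with hℓ
  have hℓ1 : 1 ≤ ℓ := by
    rw [hℓ, hK]; nlinarith
  -- degree: `((p-1)ℓ)^{d+1} ≤ (log₂ (8t))^{d+2}`
  have hAL : A ^ (d + 1) ≤ L := by
    rw [hL]
    exact Nat.le_log_of_pow_le one_lt_two hNA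
  have hdeg : ((p - 1) * ℓ) ^ (d + 1) ≤ (Nat.log 2 (8 * t)) ^ (d + 2) := by
    have h1 : ((p - 1) * ℓ) ^ (d + 1) ≤ L ^ (d + 2) :=
      degree_bound (by rw [hK]; omega) (by have := hp.two_le; omega) (by rw [← hA]; exact hAL)
    refine h1.trans (Nat.pow_le_pow_left ?_ _)
    rw [hL]
    exact Nat.log_mono_right hNn
  -- the polynomial-map bound from `RingHard` at ring length `8t`
  have hB : ∀ P : Fin (N * N) → Smolensky.CubeFn (ZMod p) (8 * t),
      (∀ j, P j ∈ Smolensky.lowDeg (ZMod p) (8 * t) (((p - 1) * ℓ) ^ (d + 1))) →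
        ((univ.filter fun x : Fin (8 * t) → Bool =>
            (fun v => (fun j => decide (P j x = 1)) (finProdFinEquiv v)) ∈
              hlfSolutions (γ.ringInstance x)).card : ℝ) ≤ θ₀ * (2 : ℝ) ^ (8 * t) := by
    intro P hP
    -- the ring outputs of `P`
    let Q : Fin (8 * t) → Smolensky.CubeFn (ZMod p) (8 * t) :=
      fun i => P (finProdFinEquiv (γ.toFun i))
    have hQ : ∀ i, Q i ∈ Smolensky.lowDeg (ZMod p) (8 * t) ((Nat.log 2 (8 * t)) ^ (d + 2)) :=
      fun i => Smolensky.lowDeg_mono hdeg (hP _)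
    have hring := hn₀ t ht₀ Q hQ
    refine le_trans ?_ hring
    exact_mod_cast card_le_card fun x hx => by
      simp only [mem_filter, mem_univ, true_and] at hx ⊢
      exact GridCycle.rel_of_mem_hlfSolutions hn3 x hx
  -- the relational Razborov–Smolensky lemma
  obtain ⟨x, hx⟩ := Smolensky.exists_uniformProb_le hℓ1
    (fun x : Fin (8 * t) → Bool => encodeHLF (γ.ringInstance x))
    (GridCycle.encodeHLF_ringInstance_subst γ)
    (fun j : Fin (N * N) => Cs (finProdFinEquiv.symm j))
    (fun j => hover _) (fun j => hdep _)
    (fun x z => (fun v => z (finProdFinEquiv v)) ∈ hlfSolutions (γ.ringInstance x)) hB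
  refine ⟨γ.ringInstance x, GridCycle.ringInstance_isValid x, ?_⟩
  simp only [Equiv.symm_apply_apply] at hx
  refine hx.trans ?_
  -- the two error terms
  have h2t : (2 : ℝ) ^ (8 * t) ≠ 0 := pow_ne_zero _ two_ne_zero
  rw [mul_div_assoc, div_self h2t, mul_one]
  refine add_le_add le_rfl ?_
  -- `Σ_j (size + 2) ≤ N²(s N + 2)` and `p^ℓ ≥ N^{ks+3}`
  have hpℓpos : (0 : ℝ) < (p : ℝ) ^ ℓ := by
    have : (0 : ℝ) < p := by exact_mod_cast hp.pos
    positivity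
  have hsum : (∑ j : Fin (N * N), (((Cs (finProdFinEquiv.symm j)).size : ℝ) + 2)) ≤
      (N : ℝ) * N * (((s.eval N : ℕ) : ℝ) + 2) := by
    calc (∑ j : Fin (N * N), (((Cs (finProdFinEquiv.symm j)).size : ℝ) + 2))
        ≤ ∑ _j : Fin (N * N), (((s.eval N : ℕ) : ℝ) + 2) :=
          sum_le_sum fun j _ => by
            have := hsize (finProdFinEquiv.symm j)
            exact add_le_add (by exact_mod_cast this) le_rfl
      _ = (N : ℝ) * N * (((s.eval N : ℕ) : ℝ) + 2) := by
          rw [sum_const, card_univ, Fintype.card_fin, nsmul_eq_mul]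
          push_cast
          ring
  have hD : ((N : ℝ)) ^ (ks + 3) ≤ (p : ℝ) ^ ℓ := by
    have h1 : N ^ (ks + 3) ≤ 2 ^ ℓ := by
      rw [hℓ, hK, hL]
      exact pow_le_two_pow_log_succ_mul N (ks + 3)
    have h2 : 2 ^ ℓ ≤ p ^ ℓ := Nat.pow_le_pow_left hp.two_le ℓ
    exact_mod_cast h1.trans h2
  have hMδ : (2 * cs + 2 : ℝ) ≤ δ * N := by
    have hM1 : (1 : ℝ) / δ ≤ M := by rw [hM]; exact Nat.le_ceil _
    have hMN : ((M * (2 * cs + 2) : ℕ) : ℝ) ≤ N := by exact_mod_cast hNM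
    push_cast at hMN
    have hMδ' : 1 ≤ δ * (M : ℝ) := by
      rw [div_le_iff₀ hδpos] at hM1
      linarith
    have h0 : (0 : ℝ) ≤ 2 * cs + 2 := by positivity
    calc (2 * cs + 2 : ℝ) = 1 * (2 * cs + 2) := by ring
      _ ≤ δ * (M : ℝ) * (2 * cs + 2) := mul_le_mul_of_nonneg_right hMδ' h0
      _ = δ * ((M : ℝ) * (2 * cs + 2)) := by ring
      _ ≤ δ * N := mul_le_mul_of_nonneg_left hMN hδpos.le
  calc (∑ j : Fin (N * N), (((Cs (finProdFinEquiv.symm j)).size : ℝ) + 2)) / (p : ℝ) ^ ℓ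
      ≤ (N : ℝ) * N * (((s.eval N : ℕ) : ℝ) + 2) / (p : ℝ) ^ ℓ :=
        div_le_div_of_nonneg_right hsum hpℓpos.le
    _ ≤ δ := error_bound (k := ks) (c := cs) (by omega) (by exact_mod_cast hcs N) hMδ hD hpℓpos

/-- **`RingHard p → HLFNotFAC0Mod p`** (via `RingHard8`). -/
theorem hlfNotFAC0Mod_of_ringHard (p : ℕ) [Fact p.Prime] (h : RingHard p) : HLFNotFAC0Mod p :=
  hlfNotFAC0Mod_of_ringHard8 p (ringHard8_of_ringHard p h)

/-- **The composite reduction**: the cell's crux (at ring lengths `8t`) implies the printed-open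
target, `RingHard8 p → AdviceFreeQNC0Sep p`. -/
theorem adviceFreeQNC0Sep_of_ringHard8 (p : ℕ) [Fact p.Prime] (h : RingHard8 p) :
    AdviceFreeQNC0Sep p :=
  adviceFreeQNC0Sep_of_hlfNotFAC0Mod p (hlfNotFAC0Mod_of_ringHard8 p h)

/-- **The composite reduction**: `RingHard p → AdviceFreeQNC0Sep p`. -/
theorem adviceFreeQNC0Sep_of_ringHard (p : ℕ) [Fact p.Prime] (h : RingHard p) :
    AdviceFreeQNC0Sep p :=
  adviceFreeQNC0Sep_of_hlfNotFAC0Mod p (hlfNotFAC0Mod_of_ringHard p h)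

/-- **Route item `BridgeRingToSep`** (stmt-QuantumAdvantage-19124): `RingHard 2 → AdviceFreeQNC0`
(the rung leaf is `AdviceFreeQNC0Sep 2` by definition). -/
theorem bridgeRingToSep_proof : Summit.QuantumAdvantage.QuantumAdvantage.Theses.RingFrame.BridgeRingToSep :=
  fun h => adviceFreeQNC0Sep_of_ringHard 2 h

end Summit.QuantumAdvantage.QuantumAdvantage.Theorems
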